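import Literature.NumberTheory.Automorphic.Qian2022PotentialAutomorphy
import Literature.NumberTheory.Automorphic.EssConjSelfDual
import HarnessLib

/-!
# Caraiani 2012, Thm. 1.1 (local–global compatibility at `v ∤ ℓ` for RACSDC automorphic representations),
# UNRAMIFIED consequence: `π_v` is unramified iff `r_ι(π)` is unramified at `v`, and then `r_ι(π)` is compatible with
# the Satake parameter

Topic `NumberTheory/Automorphic` (pattern of `Qian2022PotentialAutomorphy.lean`, `Thorne2017AutomorphyLifting.lean`, `HLTTCompatible.lean`:
`CuspidalAutomorphicRepData`, `IsRegularAlgebraic`, `AutomorphicRepData.IsEssConjSelfDual` (`EssConjSelfDual`; `χ = 1` = conjugate self-dual,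
RACSDC), `AutomorphicRepData.IsUnramifiedAt` (a Satake parameter exists), `Qian2022.IsCompatible` (the characterising property of `r_{l,ι}(π)`),
`FramedGaloisRep.IsUnramifiedAt`, `IsGaloisCompatibleAt` (unramified compatibility: `r` unramified at `v` with the Frobenius characteristic
polynomial predicted by the Satake parameter), `GaloisRep.IsSemisimple`).  Requested by the line `thorne-minimal-lift` of crux `stmt-Langlands-13757`
(fact F6 of its stub `stub_pointAutomorphicT`: hypothesis (iv)(b) "`π_v` unramified where `ρ` and `r_ι(π)` are" of the landed Thorne 2017 fact for the
base-changed companion, and the output clauses "`Π'_w` unramified with a Satake parameter and compatible with `ρ_y`" at EVERY `w ∉ S'`, not only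
over good rational primes).

A. Caraiani, *Local-global compatibility and the action of monodromy on nearby cycles*, Duke Math. J. 161 (2012) 2311–2413, **Theorem 1.1**,
as recalled in Barnet-Lamb–Gee–Geraghty–Taylor, *Potential automorphy and change of weight*, Ann. of Math. 179 (2014), §2.1 (held text
arXiv:1010.2561 p. 18, read 2026-08-17), for a RAECSDC (in particular RACSDC) automorphic representation `π` of `GL_n(𝔸_F)`, `F` imaginary CM,
and its Galois representation `r_{l,ı}(π)` ("the continuous semi-simple representation … with the properties described in Theorem 1.1 (resp.
1.2) of [BLGHT]" — characterised by compatibility with `π` at the unramified places):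

> If `v ∤ l` then Caraiani's local-global compatibility tells us that
> `ı WD(r_{l,ı}(π)|_{G_{F_v}})^{F-ss} ≅ rec(π_v ⊗ |det|_v^{(1-n)/2})`. (See [Caraiani 2012].)

(also Thorne, Math. Z. 285 (2017) §3 (i), p. 26: "`r_ι(π)` … satisfies the following local-global compatibility condition at each finite place
`v` of `F`").  Since `rec` is a bijection matching unramified generic representations with unramified Frobenius-semisimple Weil–Deligne
representations with `N = 0`, and `π_v` is generic, the displayed isomorphism gives: `π_v` is unramified ⇔ `r_{l,ı}(π)` is unramified at `v`,
and in that case the characteristic polynomial of `r_{l,ı}(π)(Frob_v)` is the one predicted by the Satake parameter (the tree's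
`IsGaloisCompatibleAt`, review-13 convention of `ReciprocityGLn`).

## What is vendored: the UNRAMIFIED consequence, RACSDC case (`χ = 1`), for a representation with the characterising property

NAMED FACT (D-0014) `Caraiani2012.unramified_compatibility_racsdc`: for `F` a CM number field, `π` a regular algebraic, conjugate self-dual,
cuspidal automorphic representation of `GL_n(𝔸_F)` and `r : Γ_F → GL_n(ℚ̄_ℓ)` SEMISIMPLE with the characterising property of `r_{l,ι}(π)`
(`Qian2022.IsCompatible π ι r`; such an `r` is `r_{l,ι}(π)` — the unique continuous semisimple representation with that property, Qian
Def. 1.3 / HLTT, the compatible places having density one): at every finite `v ∤ ℓ`, `π` is unramified at `v` iff `r` is, and `r` is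
compatible with `π` at `v` (`IsGaloisCompatibleAt`, vacuous when `π_v` is ramified).
-- TODO(general form): the full `ı WD(r|_{G_{F_v}})^{F-ss} ≅ rec(π_v ⊗ |det|^{(1-n)/2})` (monodromy and ramified `π_v`); RAECSDC `(π, χ)`
-- with `χ = χ₀ ∘ N_{F/F⁺}`, `χ₀,v(-1) = (-1)^n`; totally real `F` (RAESDC).

## References

* [Caraiani2012] A. Caraiani, Duke Math. J. 161 (2012), Thm. 1.1.
* [BarnetlambEtAl2014] T. Barnet-Lamb, T. Gee, D. Geraghty, R. Taylor, Ann. of Math. 179 (2014), §2.1 (arXiv:1010.2561 p. 18).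
* [Thorne2017TwoAdic] J. A. Thorne, Math. Z. 285 (2017), §3 (i) p. 26.
* [Qian2022] L. Qian, Invent. Math. 231 (2023), Def. 1.3 (the characterising property).
-/

noncomputable section

open scoped NumberField
open NumberField IsDedekindDomain Field
open Literature.NumberTheory.GaloisRepresentations

namespace Literature.NumberTheory.Automorphic

namespace Caraiani2012

/-- **Caraiani 2012, Thm. 1.1 — unramified consequence, RACSDC case**, NAMED FACT.  For every CM number field `F`, `n`, prime `ℓ`,
`ι : ℚ̄_ℓ ≃ ℂ`, regular algebraic conjugate self-dual cuspidal `π` on `GL_n(𝔸_F)` and semisimple `r : Γ_F → GL_n(ℚ̄_ℓ)` with the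
characterising property of `r_{l,ι}(π)` (`Qian2022.IsCompatible`): at every finite place `v ∤ ℓ`, `π` is unramified at `v` iff `r` is
unramified at `v`, and `r` is compatible with `π` at `v` (`IsGaloisCompatibleAt`: Frobenius characteristic polynomial predicted by the Satake
parameter).  Printed source quoted in the module docstring (via BLGGT §2.1).
[cite: Caraiani2012, Thm. 1.1] [cite: BarnetlambEtAl2014, §2.1 (arXiv p. 18)] -/
def unramified_compatibility_racsdc : Prop :=
  ∀ (F : Type) [Field F] [NumberField F] [IsCMField F] (n : ℕ) (ℓ : ℕ) [Fact ℓ.Prime]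
    (hcpt : isCompact_glFiniteIntegralLevel n F) (ι : PadicAlgCl ℓ ≃+* ℂ)
    (π : CuspidalAutomorphicRepData n F hcpt) (r : FramedGaloisRep F (PadicAlgCl ℓ) n),
    π.1.IsRegularAlgebraic → π.1.IsEssConjSelfDual 1 →
    r.toGaloisRep.IsSemisimple → Qian2022.IsCompatible π.1 ι r →
    ∀ v : HeightOneSpectrum (𝓞 F), ((ℓ : ℕ) : 𝓞 F) ∉ v.asIdeal →
      (π.1.IsUnramifiedAt v ↔ r.IsUnramifiedAt v) ∧ IsGaloisCompatibleAt π.1 ι r v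

end Caraiani2012

end Literature.NumberTheory.Automorphic

end
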